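import Mathlib
import Literature.NumberTheory.Transcendental.DrinfeldAssociatorTransport
import Literature.NumberTheory.Transcendental.AssociatorsHexagonProofs
import Literature.NumberTheory.Transcendental.DrinfeldAssociatorParametric
import HarnessLib

/-!
# Trivial holonomy of the KZ connection around polygons in the pentagon cell of `M_{0,5}(ℝ)`

Fifth proofs file towards `drinfeldAssociator_pentagon` (`DrinfeldAssociator.lean`,
[Drinfeld1991, (2.13)]): the two-dimensional half of Drinfeld's argument. On the cell
`U = {0 < u < v < 1}` (points `z₁ = 0 < z₂ = u < z₃ = v < z₄ = 1` of `M_{0,5}(ℝ)`), the KZ connection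
`Ω = Σ_ℓ t_ℓ dlog ℓ` over the five lines `ℓ ∈ {u, 1-u, v, 1-v, v-u}` (`L5`) with values in the
truncated Drinfeld–Kohno algebra `A_N = DrinfeldKohnoTrunc ℝ (Fin 4) N` (`u ↦ t₀₁`, `1-u ↦ t₁₃`,
`v ↦ t₀₂`, `1-v ↦ t₂₃`, `v-u ↦ t₁₂`, strands `1,2,3,4 ↦ 0,1,2,3`) is FLAT: `[Ω(∂_u), Ω(∂_v)] = 0`
(`OmX_mul_OmY`, from the infinitesimal braid relations `[t_ij, t_ik + t_jk] = 0`, locality, and the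
two Arnold partial-fraction identities) [Drinfeld1991, §2]. Consequently the transport of `Ω` along
straight segments (`segT p q`, a free series over `L5` as in `DrinfeldAssociatorTransport.lean`,
evaluated in `A_N` by `ev = NCSeries.evalTrunc N tOf`) has trivial holonomy around every triangle
(`holonomy_triangle`) and hence around every closed pentagon in the cell (`holonomy_pentagon`).
Everything is proved; no named fact is introduced.

## The argument (Chen's variation formula, nilpotent version)

For a triangle `p, q, r ∈ U` let `γ(s) = q + s(r-q)` and consider `X(s) = T̂(γ(s)→p) · T̂(q→γ(s))`.
The second factor has `∂_s = ω̂(s) ·` (FTC). For the first, the segment from the MOVING point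
`γ(s)` to `p` is `σ ↦ H(s,σ) = γ(s) + σ(p - γ(s))`; its densities `g_ℓ = ∂_σ log ℓ(H)` and the
transversal ones `h_ℓ = ∂_s log ℓ(H)` (clamped to the parameter square, `gMov`, `hMov`, so that the
generic parametric calculus of `DrinfeldAssociatorParametric.lean` applies) satisfy `∂_s g = ∂_σ h`,
whence the variation identity `∂_σ M̂ = ĝ M̂ + [ĝ, b̂] Ĵ` for `M̂ = ∂_s Ĵ - b̂ Ĵ + Ĵ b̂(0)`; flatness kills
`ev [ĝ, b̂]`, nilpotent uniqueness gives `ev M̂ ≡ 0`, and at `σ = 1` (`b̂(1) = 0`,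
`b̂(0) = ω̂(s)`): `ev(∂_s T̂(γ(s)→p)) = -ev(T̂(γ(s)→p)) ev(ω̂(s))` (`ev_pDser_one`). Hence
`ev(∂_s X) = 0`, `ev(X(1)) = ev(X(0))`, i.e. `ev(T̂(r→p) T̂(q→r)) = ev(T̂(q→p))`, and with the
reversal `T̂(q→p) T̂(p→q) = 1` (`segT_reverse_mul`) the triangle closes.

## References

* V. G. Drinfel'd, Leningrad Math. J. 2 (1991), 829–860, §2 (flatness of KZ, the pentagon from
  `KZ₄`). [Drinfeld1991]
* H. Furusho, Publ. RIMS 39 (2003), §3.1 (KZ conventions). [Furusho2003]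
* K.-T. Chen, Bull. AMS 83 (1977), §2. Standard material: `[folklore]`.
-/

noncomputable section

open MeasureTheory intervalIntegral Set Filter Metric
open scoped BigOperators Topology

namespace Literature.NumberTheory.Transcendental


/-! ## 1. The five lines of the pentagon cell `U = {0 < u < v < 1} ⊂ M_{0,5}(ℝ)` -/

/-- The five boundary lines `u, 1-u, v, 1-v, v-u` of the pentagon cell (letters of the KZ connection
on `M_{0,5}` in the simplicial coordinates `z₁ = 0 < z₂ = u < z₃ = v < z₄ = 1`). [cite:
Drinfeld1991, §2] -/
inductive L5
  | u | omu | v | omv | vmu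
  deriving DecidableEq, Repr

namespace L5

/-- The five lines form a finite type. [folklore] -/
instance : Fintype L5 := ⟨{u, omu, v, omv, vmu}, fun x => by cases x <;> simp⟩

/-- The five lines as a `Finset`. [folklore] -/
theorem univ_eq : (Finset.univ : Finset L5) = {u, omu, v, omv, vmu} := rfl

/-- Sums over the five lines, expanded. [folklore] -/
theorem sum_univ {M : Type*} [AddCommMonoid M] (f : L5 → M) :
    ∑ ℓ, f ℓ = f u + f omu + f v + f omv + f vmu := by
  rw [univ_eq]
  simp [Finset.sum_insert, add_assoc]

/-- The affine function of a line at a point `x = (u, v)`. [folklore] -/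
def val : L5 → ℝ × ℝ → ℝ
  | u, x => x.1
  | omu, x => 1 - x.1
  | v, x => x.2
  | omv, x => 1 - x.2
  | vmu, x => x.2 - x.1

/-- The linear part of a line applied to a direction. [folklore] -/
def slope : L5 → ℝ × ℝ → ℝ
  | u, d => d.1
  | omu, d => -d.1
  | v, d => d.2
  | omv, d => -d.2
  | vmu, d => d.2 - d.1

/-- `ℓ(x + t d) = ℓ(x) + t ∇ℓ·d` (the lines are affine). [folklore] -/
theorem val_add_smul (ℓ : L5) (x d : ℝ × ℝ) (t : ℝ) :
    ℓ.val (x + t • d) = ℓ.val x + t * ℓ.slope d := by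
  cases ℓ <;> simp [val, slope] <;> ring

/-- `∇ℓ·(-d) = -∇ℓ·d`. [folklore] -/
theorem slope_neg (ℓ : L5) (d : ℝ × ℝ) : ℓ.slope (-d) = -ℓ.slope d := by
  cases ℓ <;> simp [slope]; ring

/-- `∇ℓ·(t d) = t ∇ℓ·d`. [folklore] -/
theorem slope_smul (ℓ : L5) (t : ℝ) (d : ℝ × ℝ) : ℓ.slope (t • d) = t * ℓ.slope d := by
  cases ℓ <;> simp [slope]; ring

/-- `∇ℓ·(x - y) = ℓ(x) - ℓ(y)`. [folklore] -/
theorem slope_sub (ℓ : L5) (x y : ℝ × ℝ) : ℓ.slope (x - y) = ℓ.val x - ℓ.val y := by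
  cases ℓ <;> simp [slope, val]; ring

/-- The lines are continuous functions. [folklore] -/
theorem continuous_val (ℓ : L5) : Continuous ℓ.val := by
  cases ℓ
  · exact continuous_fst
  · exact continuous_const.sub continuous_fst
  · exact continuous_snd
  · exact continuous_const.sub continuous_snd
  · exact continuous_snd.sub continuous_fst

end L5

/-- The open pentagon cell `U = {(u,v) | 0 < u < v < 1}` (a connected component of `M_{0,5}(ℝ)`).
[cite: Drinfeld1991, §2] -/
def cellU : Set (ℝ × ℝ) := {x | 0 < x.1 ∧ x.1 < x.2 ∧ x.2 < 1}

/-- The five lines are positive on the cell. [folklore] -/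
theorem L5.val_pos (ℓ : L5) {x : ℝ × ℝ} (hx : x ∈ cellU) : 0 < ℓ.val x := by
  obtain ⟨h1, h2, h3⟩ := hx
  cases ℓ <;> simp only [L5.val] <;> linarith

/-- The cell is convex. [folklore] -/
theorem convex_cellU : Convex ℝ cellU := by
  intro x hx y hy a b ha hb hab
  obtain ⟨hx1, hx2, hx3⟩ := hx
  obtain ⟨hy1, hy2, hy3⟩ := hy
  simp only [cellU, mem_setOf_eq, Prod.fst_add, Prod.smul_fst, Prod.snd_add, Prod.smul_snd,
    smul_eq_mul]
  refine ⟨?_, ?_, ?_⟩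
  · rcases ha.lt_or_eq with ha' | rfl
    · nlinarith
    · simp at hab; subst hab; simpa using hy1
  · rcases ha.lt_or_eq with ha' | rfl
    · nlinarith
    · simp at hab; subst hab; simpa using hy2
  · rcases ha.lt_or_eq with ha' | rfl
    · nlinarith
    · simp at hab; subst hab; simpa using hy3

/-- Points of segments inside the cell stay in the cell. [folklore] -/
theorem segment_mem_cellU {p q : ℝ × ℝ} (hp : p ∈ cellU) (hq : q ∈ cellU) {σ : ℝ}
    (hσ : σ ∈ Icc (0 : ℝ) 1) : p + σ • (q - p) ∈ cellU := by
  have : p + σ • (q - p) = (1 - σ) • p + σ • q := by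
    simp only [smul_sub]; module
  rw [this]
  exact convex_cellU hp hq (by linarith [hσ.2]) hσ.1 (by ring)

/-! ## 2. The truncated Drinfeld–Kohno algebra: letters ↦ generators, nilpotency, flatness -/

section Algebra

variable (N : ℕ)

/-- The truncated Drinfeld–Kohno algebra `A_N = U𝔞₄ ⊗ ℝ / (deg > N)`. [folklore] -/
abbrev A4 (N : ℕ) : Type := DrinfeldKohnoTrunc ℝ (Fin 4) N

/-- The generator attached to each line (strands `1,2,3,4 ↦ 0,1,2,3`): `u = z₂-z₁ ↦ t₀₁`, `1-u =
z₄-z₂ ↦ t₁₃`, `v = z₃-z₁ ↦ t₀₂`, `1-v = z₄-z₃ ↦ t₂₃`, `v-u = z₃-z₂ ↦ t₁₂`. [cite: Drinfeld1991, §2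
(KZ_4)] -/
def tOf : L5 → A4 N
  | L5.u => DrinfeldKohnoTrunc.t ℝ N 0 1
  | L5.omu => DrinfeldKohnoTrunc.t ℝ N 1 3
  | L5.v => DrinfeldKohnoTrunc.t ℝ N 0 2
  | L5.omv => DrinfeldKohnoTrunc.t ℝ N 2 3
  | L5.vmu => DrinfeldKohnoTrunc.t ℝ N 1 2

/-- The letters evaluate to generators (weight one). [folklore] -/
theorem tOf_mem_genSpan (ℓ : L5) :
    tOf N ℓ ∈ (DrinfeldKohnoTrunc.genSpan : Submodule ℝ (A4 N)) := by
  cases ℓ <;> exact DrinfeldKohnoTrunc.t_mem_genSpan _ _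

/-- Nilpotency of the substitution: products of more than `N` letters vanish. [folklore] -/
theorem tOf_nilpotent (w : List L5) (hw : N < w.length) : (w.map (tOf N)).prod = 0 :=
  DrinfeldKohnoTrunc.prod_map_eq_zero_of_mem_genSpan _ (tOf_mem_genSpan N) w hw

/-- The evaluation `ev : ℝ⟨⟨L5⟩⟩ → A_N`, letters to generators, words of length `> N` to `0`.
[folklore] -/
abbrev ev (S : NCSeries L5 ℝ) : A4 N := NCSeries.evalTrunc N (tOf N) S

/-- `ev` is multiplicative. [folklore] -/
theorem ev_mul (S T : NCSeries L5 ℝ) : ev N (S * T) = ev N S * ev N T :=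
  NCSeries.evalTrunc_mul N (tOf N) (tOf_nilpotent N) S T

/-- `ev 1 = 1`. [folklore] -/
@[simp] theorem ev_one : ev N (1 : NCSeries L5 ℝ) = 1 := NCSeries.evalTrunc_one N _

/-- `ev` is additive. [folklore] -/
theorem ev_add (S T : NCSeries L5 ℝ) : ev N (S + T) = ev N S + ev N T := NCSeries.evalTrunc_add N _ S T

/-- `ev` is homogeneous. [folklore] -/
theorem ev_smul (c : ℝ) (S : NCSeries L5 ℝ) : ev N (c • S) = c • ev N S := NCSeries.evalTrunc_smul N _ c S

/-- `ev 0 = 0`. [folklore] -/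
theorem ev_zero : ev N (0 : NCSeries L5 ℝ) = 0 := by
  have h := ev_smul N 0 (0 : NCSeries L5 ℝ)
  rwa [zero_smul, zero_smul] at h

/-- `ev (-S) = -ev S`. [folklore] -/
theorem ev_neg (S : NCSeries L5 ℝ) : ev N (-S) = -ev N S := by
  have h := ev_smul N (-1) S
  rwa [neg_one_smul, neg_one_smul] at h

/-- `ev` respects subtraction. [folklore] -/
theorem ev_sub (S T : NCSeries L5 ℝ) : ev N (S - T) = ev N S - ev N T := by
  rw [sub_eq_add_neg, ev_add, ev_neg, sub_eq_add_neg]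

/-- A letter series is a combination of letters. [folklore] -/
theorem letterSeries_eq_sum_letter (k : L5 → ℝ) :
    NCSeries.letterSeries k = ∑ ℓ, k ℓ • (NCSeries.letter ℓ : NCSeries L5 ℝ) := by
  ext w
  rw [NCSeries.finset_sum_apply]
  simp only [NCSeries.smul_apply, NCSeries.letter_apply, smul_eq_mul, mul_ite, mul_one, mul_zero]
  match w with
  | [] => simp
  | [c] => simp
  | c :: d :: w => simp [NCSeries.letterSeries_cons_cons]

/-- `ev (Σ_ℓ k_ℓ ℓ) = Σ_ℓ k_ℓ t_ℓ`. [folklore] -/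
theorem ev_letterSeries (k : L5 → ℝ) : ev N (NCSeries.letterSeries k) = ∑ ℓ, k ℓ • tOf N ℓ := by
  rw [letterSeries_eq_sum_letter, ev, NCSeries.evalTrunc_finset_sum]
  refine Finset.sum_congr rfl fun ℓ _ => ?_
  rw [NCSeries.evalTrunc_smul, NCSeries.evalTrunc_letter N (tOf N) (tOf_nilpotent N)]

/-- The weight filtration `T_j = (products of j generators) · A_N` (`⊤ = T₀ ⊇ ⋯ ⊇ T_{N+1} = 0`).
[folklore] -/
def Tfil (j : ℕ) : Submodule ℝ (A4 N) := DrinfeldKohnoTrunc.prodSpan j * ⊤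

/-- `T₀ = ⊤`. [folklore] -/
theorem Tfil_zero : Tfil N 0 = ⊤ := by
  rw [Tfil, eq_top_iff]
  intro x _
  have h1 : (1 : A4 N) ∈ (DrinfeldKohnoTrunc.prodSpan 0 : Submodule ℝ (A4 N)) :=
    Submodule.subset_span ⟨fun i => i.elim0, by simp⟩
  simpa using Submodule.mul_mem_mul h1 (Submodule.mem_top : x ∈ (⊤ : Submodule ℝ (A4 N)))

/-- `T_{N+1} = ⊥`. [folklore] -/
theorem Tfil_succ_N : Tfil N (N + 1) = ⊥ := by
  rw [Tfil, DrinfeldKohnoTrunc.prodSpan_succ_eq_bot, Submodule.bot_mul]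

/-- `t_ℓ · T_j ⊆ T_{j+1}`. [folklore] -/
theorem tOf_mul_mem_Tfil (j : ℕ) (ℓ : L5) {x : A4 N} (hx : x ∈ Tfil N j) : tOf N ℓ * x ∈ Tfil N (j + 1) := by
  rw [Tfil] at hx ⊢
  refine Submodule.mul_induction_on hx (fun a ha y hy => ?_) (fun x y hx hy => ?_)
  · rw [← mul_assoc]
    exact Submodule.mul_mem_mul (DrinfeldKohnoTrunc.genSpan_mul_prodSpan_le j
      (Submodule.mul_mem_mul (tOf_mem_genSpan N ℓ) ha)) hy
  · rw [mul_add]; exact Submodule.add_mem _ hx hy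

end Algebra

/-! ## 3. Flatness of the KZ connection on the cell -/

section Flat

variable (N : ℕ)

/-- The KZ connection form on the cell evaluated on a direction `d` at `x`: `Ω_x(d) = Σ_ℓ (∇ℓ·d /
ℓ(x)) t_ℓ`. [cite: Drinfeld1991, §2] -/
def Omega (x d : ℝ × ℝ) : A4 N := ∑ ℓ, (ℓ.slope d / ℓ.val x) • tOf N ℓ

/-- `X = t₀₁/u - t₁₃/(1-u) - t₁₂/(v-u)`, the `du`-component of `Ω`. [folklore] -/
def OmX (x : ℝ × ℝ) : A4 N :=
  (1 / x.1) • DrinfeldKohnoTrunc.t ℝ N 0 1 - (1 / (1 - x.1)) • DrinfeldKohnoTrunc.t ℝ N 1 3 -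
    (1 / (x.2 - x.1)) • DrinfeldKohnoTrunc.t ℝ N 1 2

/-- `Y = t₀₂/v - t₂₃/(1-v) + t₁₂/(v-u)`, the `dv`-component of `Ω`. [folklore] -/
def OmY (x : ℝ × ℝ) : A4 N :=
  (1 / x.2) • DrinfeldKohnoTrunc.t ℝ N 0 2 - (1 / (1 - x.2)) • DrinfeldKohnoTrunc.t ℝ N 2 3 +
    (1 / (x.2 - x.1)) • DrinfeldKohnoTrunc.t ℝ N 1 2

/-- `Ω_x(d) = d₁ X + d₂ Y`. [folklore] -/
theorem Omega_eq (x d : ℝ × ℝ) : Omega N x d = d.1 • OmX N x + d.2 • OmY N x := by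
  simp only [Omega, L5.sum_univ, L5.slope, L5.val, tOf, OmX, OmY, smul_sub, smul_add, smul_smul]
  have e1 : -d.1 / (1 - x.1) = -(d.1 * (1 / (1 - x.1))) := by ring
  have e2 : -d.2 / (1 - x.2) = -(d.2 * (1 / (1 - x.2))) := by ring
  have e3 : (d.2 - d.1) / (x.2 - x.1) = d.2 * (1 / (x.2 - x.1)) + -(d.1 * (1 / (x.2 - x.1))) := by ring
  rw [div_eq_mul_one_div d.1, div_eq_mul_one_div d.2, e1, e2, e3, add_smul, neg_smul, neg_smul, neg_smul]
  abel

/-- **`[X, Y] = 0`: flatness of KZ on `M_{0,5}`** from the infinitesimal braid relations `[t_ij,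
t_ik + t_jk] = 0`, locality `[t₀₁, t₂₃] = [t₀₂, t₁₃] = 0`, and the Arnold identities `-1/(uv) +
1/(u(v-u)) - 1/(v(v-u)) = 0`, `1/((v-u)(1-v)) - 1/((1-u)(v-u)) - 1/((1-u)(1-v)) = 0`. [cite:
Drinfeld1991, §2] -/
theorem OmX_mul_OmY {x : ℝ × ℝ} (h1 : x.1 ≠ 0) (h2 : x.2 ≠ 0) (h3 : 1 - x.1 ≠ 0) (h4 : 1 - x.2 ≠ 0)
    (h5 : x.2 - x.1 ≠ 0) : OmX N x * OmY N x = OmY N x * OmX N x := by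
  set a := DrinfeldKohnoTrunc.t ℝ N (0 : Fin 4) 1 with ha
  set b := DrinfeldKohnoTrunc.t ℝ N (0 : Fin 4) 2 with hb
  set c := DrinfeldKohnoTrunc.t ℝ N (1 : Fin 4) 2 with hc
  set d := DrinfeldKohnoTrunc.t ℝ N (1 : Fin 4) 3 with hd
  set e := DrinfeldKohnoTrunc.t ℝ N (2 : Fin 4) 3 with he
  -- the six relations
  have rab : a * b = b * a - a * c + c * a := by
    have h := DrinfeldKohnoTrunc.t_mul_add (R := ℝ) (N := N) (0 : Fin 4) 1 2 (by decide) (by decide) (by decide)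
    rw [← ha, ← hb, ← hc, mul_add, add_mul] at h
    calc a * b = a * b + a * c - a * c := by abel
      _ = b * a + c * a - a * c := by rw [h]
      _ = _ := by abel
  have rcb : c * b = b * c + a * c - c * a := by
    have h := DrinfeldKohnoTrunc.t_mul_add (R := ℝ) (N := N) (1 : Fin 4) 2 0 (by decide) (by decide) (by decide)
    rw [DrinfeldKohnoTrunc.t_symm 1 0, DrinfeldKohnoTrunc.t_symm 2 0, ← ha, ← hb, ← hc, mul_add,
      add_mul] at h
    calc c * b = c * a + c * b - c * a := by abel
      _ = a * c + b * c - c * a := by rw [h]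
      _ = _ := by abel
  have rae : a * e = e * a :=
    DrinfeldKohnoTrunc.t_comm (0 : Fin 4) 1 2 3 (by decide) (by decide) (by decide) (by decide)
      (by decide) (by decide)
  have rdb : d * b = b * d := by
    have := DrinfeldKohnoTrunc.t_comm (R := ℝ) (N := N) (1 : Fin 4) 3 0 2 (by decide) (by decide)
      (by decide) (by decide) (by decide) (by decide)
    exact this
  have rde : d * e = e * d - d * c + c * d := by
    have h := DrinfeldKohnoTrunc.t_mul_add (R := ℝ) (N := N) (1 : Fin 4) 3 2 (by decide) (by decide) (by decide)
    rw [DrinfeldKohnoTrunc.t_symm 3 2, ← hc, ← hd, ← he, mul_add, add_mul] at h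
    calc d * e = d * c + d * e - d * c := by abel
      _ = c * d + e * d - d * c := by rw [h]
      _ = _ := by abel
  have rce : c * e = e * c + d * c - c * d := by
    have h := DrinfeldKohnoTrunc.t_mul_add (R := ℝ) (N := N) (1 : Fin 4) 2 3 (by decide) (by decide) (by decide)
    rw [← hc, ← hd, ← he, mul_add, add_mul] at h
    calc c * e = c * d + c * e - c * d := by abel
      _ = d * c + e * c - c * d := by rw [h]
      _ = _ := by abel
  -- scalars and the two partial-fraction identities
  set p₁ := 1 / x.1 with hp₁
  set p₂ := 1 / (1 - x.1) with hp₂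
  set p₃ := 1 / (x.2 - x.1) with hp₃
  set q₁ := 1 / x.2 with hq₁
  set q₂ := 1 / (1 - x.2) with hq₂
  have hid1 : p₁ * p₃ = q₁ * (p₁ + p₃) := by
    rw [hp₁, hp₃, hq₁]; field_simp; ring
  have hid2 : p₃ * q₂ = p₂ * (p₃ + q₂) := by
    rw [hp₂, hp₃, hq₂]; field_simp; ring
  show (p₁ • a - p₂ • d - p₃ • c) * (q₁ • b - q₂ • e + p₃ • c) =
    (q₁ • b - q₂ • e + p₃ • c) * (p₁ • a - p₂ • d - p₃ • c)
  simp only [sub_mul, mul_sub, add_mul, mul_add, smul_mul_assoc, mul_smul_comm, smul_sub, smul_add,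
    smul_smul, rab, rcb, rae, rdb, rde, rce]
  match_scalars <;> first | ring1 | linear_combination hid1 | linear_combination -hid1 |
    linear_combination hid2 | linear_combination -hid2

end Flat

section Flat2
variable (N : ℕ)

/-- **Flatness**: `[Ω_x(d), Ω_x(d')] = 0` at every point of the cell. [cite: Drinfeld1991, §2] -/
theorem Omega_comm {x : ℝ × ℝ} (hx : x ∈ cellU) (d d' : ℝ × ℝ) :
    Omega N x d * Omega N x d' = Omega N x d' * Omega N x d := by
  obtain ⟨hx1, hx2, hx3⟩ := hx
  have hXY := OmX_mul_OmY N (x := x) hx1.ne' (by linarith) (by linarith) (by linarith) (by linarith)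
  rw [Omega_eq, Omega_eq]
  simp only [add_mul, mul_add, smul_mul_assoc, mul_smul_comm, hXY]
  module

/-- `ev` of the letter series with coefficients `∇ℓ·d/ℓ(x)` is `Ω_x(d)`. [folklore] -/
theorem ev_letterSeries_eq_Omega (x d : ℝ × ℝ) :
    ev N (NCSeries.letterSeries fun ℓ => ℓ.slope d / ℓ.val x) = Omega N x d :=
  ev_letterSeries N _

end Flat2

/-! ## 4. Segment transports in the cell -/

section Segment
variable (N : ℕ)

/-- The pulled-back densities of `dlog ℓ` along the segment `σ ↦ p + σ(q - p)`: `f_ℓ(σ) = ∇ℓ·(q-p) /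
ℓ(p + σ(q-p))`. [folklore] -/
def segDens (p q : ℝ × ℝ) : L5 → ℝ → ℝ := fun ℓ σ => ℓ.slope (q - p) / ℓ.val (p + σ • (q - p))

/-- The parameter domain where all five lines are positive along the (prolonged) segment. [folklore]
-/
def segDom (p q : ℝ × ℝ) : Set ℝ := {σ | ∀ ℓ : L5, 0 < ℓ.val (p + σ • (q - p))}

/-- The parameter domain is open. [folklore] -/
theorem isOpen_segDom (p q : ℝ × ℝ) : IsOpen (segDom p q) := by
  have : segDom p q = ⋂ ℓ : L5, {σ | 0 < ℓ.val (p + σ • (q - p))} := by ext; simp [segDom]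
  rw [this]
  refine isOpen_iInter_of_finite fun ℓ => ?_
  exact isOpen_lt continuous_const ((L5.continuous_val ℓ).comp (by fun_prop))

/-- The parameter domain is an interval (the lines are affine). [folklore] -/
theorem ordConnected_segDom (p q : ℝ × ℝ) : (segDom p q).OrdConnected := by
  refine ⟨fun a ha b hb σ hσ ℓ => ?_⟩
  have ha' := ha ℓ; have hb' := hb ℓ
  rw [L5.val_add_smul] at ha' hb' ⊢
  -- affine in σ, positive at both ends
  rcases le_or_gt 0 (ℓ.slope (q - p)) with h | h
  · calc 0 < ℓ.val p + a * ℓ.slope (q - p) := ha'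
      _ ≤ ℓ.val p + σ * ℓ.slope (q - p) := by nlinarith [hσ.1]
  · calc 0 < ℓ.val p + b * ℓ.slope (q - p) := hb'
      _ ≤ ℓ.val p + σ * ℓ.slope (q - p) := by nlinarith [hσ.2]

/-- `[0,1]` lies in the parameter domain for a segment in the cell. [folklore] -/
theorem mem_segDom {p q : ℝ × ℝ} (hp : p ∈ cellU) (hq : q ∈ cellU) {σ : ℝ} (hσ : σ ∈ Icc (0 : ℝ) 1) :
    σ ∈ segDom p q := fun ℓ => ℓ.val_pos (segment_mem_cellU hp hq hσ)

/-- `[0,1] ⊆` the parameter domain. [folklore] -/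
theorem Icc_subset_segDom {p q : ℝ × ℝ} (hp : p ∈ cellU) (hq : q ∈ cellU) :
    Icc (0 : ℝ) 1 ⊆ segDom p q := fun _ hσ => mem_segDom hp hq hσ

/-- The segment densities are continuous on the parameter domain. [folklore] -/
theorem continuousOn_segDens (p q : ℝ × ℝ) (ℓ : L5) : ContinuousOn (segDens p q ℓ) (segDom p q) := by
  refine continuousOn_const.div ((L5.continuous_val ℓ).comp_continuousOn (by fun_prop)) ?_
  exact fun σ hσ => (hσ ℓ).ne'

/-- **The transport of the KZ connection along the segment from `p` to `q`**, a free series over the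
five lines: `T̂(p→q) = Σ_w I_w w`. [folklore] -/
def segT (p q : ℝ × ℝ) : NCSeries L5 ℝ := transportSeries (segDens p q) 0 1

/-- The reversed segment's densities are the reparametrised (`σ ↦ 1 - σ`) densities. [folklore] -/
theorem segDens_reverse (p q : ℝ × ℝ) (ℓ : L5) (σ : ℝ) :
    segDens q p ℓ σ = segDens p q ℓ (1 - σ) * (-1) := by
  simp only [segDens]
  have h1 : q + σ • (p - q) = p + (1 - σ) • (q - p) := by module
  rw [h1, show p - q = -(q - p) by abel, L5.slope_neg]
  ring

/-- **Reversal**: `T̂(q→p) T̂(p→q) = 1`. [folklore] -/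
theorem segT_reverse_mul {p q : ℝ × ℝ} (hp : p ∈ cellU) (hq : q ∈ cellU) :
    segT q p * segT p q = 1 := by
  have h01 : (0 : ℝ) ∈ segDom p q := mem_segDom hp hq ⟨le_rfl, zero_le_one⟩
  have h11 : (1 : ℝ) ∈ segDom p q := mem_segDom hp hq ⟨zero_le_one, le_rfl⟩
  -- T̂(q→p) as the reparametrised transport of `segDens p q` from 1 to 0
  have hcomp := transportSeries_comp (isOpen_segDom p q) (ordConnected_segDom p q)
    (continuousOn_segDens p q) (s' := segDom q p) (isOpen_segDom q p) (ordConnected_segDom q p)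
    (φ := fun σ => 1 - σ) (φ' := fun _ => -1)
    (fun x _ => by simpa using (hasDerivAt_id x).const_sub (1 : ℝ))
    continuousOn_const (fun σ hσ ℓ => by
      have := hσ ℓ
      have h1 : q + σ • (p - q) = p + (1 - σ) • (q - p) := by module
      rwa [h1] at this)
    (a := 0) (b := 1) (mem_segDom hq hp ⟨le_rfl, zero_le_one⟩) (mem_segDom hq hp ⟨zero_le_one, le_rfl⟩)
  have hdens : (fun c x => segDens p q c (1 - x) * -1) = segDens q p := by
    funext c x; exact (segDens_reverse p q c x).symm
  rw [hdens] at hcomp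
  simp only [sub_zero, sub_self] at hcomp
  rw [segT, segT, ← hcomp]
  exact transportSeries_reverse_mul (isOpen_segDom p q) (ordConnected_segDom p q)
    (continuousOn_segDens p q) h01 h11

/-- The transport series along a segment is group-like. [folklore] -/
theorem isGroupLike_segT {p q : ℝ × ℝ} (hp : p ∈ cellU) (hq : q ∈ cellU) :
    NCSeries.IsGroupLike (segT p q) :=
  isGroupLike_transportSeries (isOpen_segDom p q) (ordConnected_segDom p q) (continuousOn_segDens p q)
    (mem_segDom hp hq ⟨le_rfl, zero_le_one⟩) (mem_segDom hp hq ⟨zero_le_one, le_rfl⟩)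

/-- `ev(T̂(q→p)) ev(T̂(p→q)) = 1`. [folklore] -/
theorem ev_segT_reverse_mul {p q : ℝ × ℝ} (hp : p ∈ cellU) (hq : q ∈ cellU) :
    ev N (segT q p) * ev N (segT p q) = 1 := by
  rw [← ev_mul, segT_reverse_mul hp hq, ev_one]

/-- `ev(T̂(p→q)) ev(T̂(q→p)) = 1`. [folklore] -/
theorem ev_segT_mul_reverse {p q : ℝ × ℝ} (hp : p ∈ cellU) (hq : q ∈ cellU) :
    ev N (segT p q) * ev N (segT q p) = 1 := by
  rw [← ev_mul, segT_reverse_mul hq hp, ev_one]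

end Segment

/-! ## 5. The moving segment: densities of `σ ↦ γ(s) + σ (p - γ(s))`, `γ(s) = q + s (r - q)` -/

section Moving

/-- The clamp `ℝ → [0,1]` (`Set.projIcc`). [folklore] -/
def cl (t : ℝ) : ℝ := (projIcc (0 : ℝ) 1 zero_le_one t : ℝ)

/-- The clamp is continuous. [folklore] -/
theorem continuous_cl : Continuous cl := continuous_subtype_val.comp continuous_projIcc

/-- The clamp lands in `[0,1]`. [folklore] -/
theorem cl_mem (t : ℝ) : cl t ∈ Icc (0 : ℝ) 1 := (projIcc (0 : ℝ) 1 zero_le_one t).2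

/-- The clamp is the identity on `[0,1]`. [folklore] -/
theorem cl_of_mem {t : ℝ} (ht : t ∈ Icc (0 : ℝ) 1) : cl t = t := by
  simp [cl, projIcc_of_mem zero_le_one ht]

/-- Near an interior point the clamp is the identity. [folklore] -/
theorem cl_eventuallyEq {s : ℝ} (hs : s ∈ Ioo (0 : ℝ) 1) : cl =ᶠ[𝓝 s] id := by
  filter_upwards [Ioo_mem_nhds hs.1 hs.2] with x hx
  exact cl_of_mem ⟨hx.1.le, hx.2.le⟩

variable (p q r : ℝ × ℝ)

/-- The moving point `γ(s) = q + s (r - q)` on the segment from `q` to `r`. [folklore] -/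
def gam (s : ℝ) : ℝ × ℝ := q + s • (r - q)

/-- The homotopy `H(s, σ) = γ(s) + σ (p - γ(s))` (segment from the moving point to `p`). [folklore]
-/
def Hom (s σ : ℝ) : ℝ × ℝ := gam q r s + σ • (p - gam q r s)

/-- `ℓ(H(s,σ)) = ℓ(γ(s)) + σ (ℓ(p) - ℓ(γ(s)))`. [folklore] -/
theorem val_Hom (ℓ : L5) (s σ : ℝ) :
    ℓ.val (Hom p q r s σ) = ℓ.val (gam q r s) + σ * (ℓ.val p - ℓ.val (gam q r s)) := by
  rw [Hom, L5.val_add_smul, L5.slope_sub]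

/-- `ℓ(γ(s)) = ℓ(q) + s ∇ℓ·(r-q)`. [folklore] -/
theorem val_gam (ℓ : L5) (s : ℝ) : ℓ.val (gam q r s) = ℓ.val q + s * ℓ.slope (r - q) := by
  rw [gam, L5.val_add_smul]

/-- The (clamped) densities `g_ℓ(s,σ) = ∇ℓ·(p - γ(s)) / ℓ(H(s,σ)) = ∂_σ log ℓ(H)` of the segment
`γ(s) → p`. [folklore] -/
def gMov (ℓ : L5) (s σ : ℝ) : ℝ :=
  (ℓ.val p - ℓ.val (gam q r (cl s))) / ℓ.val (Hom p q r (cl s) (cl σ))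

/-- The (clamped) `s`-derivative `g'_ℓ(s,σ) = -∇ℓ·(r-q) ℓ(p) / ℓ(H(s,σ))²`. [folklore] -/
def gMov' (ℓ : L5) (s σ : ℝ) : ℝ :=
  -(ℓ.slope (r - q) * ℓ.val p) / ℓ.val (Hom p q r (cl s) (cl σ)) ^ 2

/-- The (clamped) transversal densities `h_ℓ(s,σ) = ∂_s log ℓ(H(s,σ)) = (1-σ) ∇ℓ·(r-q) / ℓ(H(s,σ))`.
[folklore] -/
def hMov (ℓ : L5) (s σ : ℝ) : ℝ :=
  (1 - cl σ) * ℓ.slope (r - q) / ℓ.val (Hom p q r (cl s) (cl σ))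

variable {p q r} (hp : p ∈ cellU) (hq : q ∈ cellU) (hr : r ∈ cellU)
include hp hq hr

omit hp in
/-- `γ(s) ∈ U` for `s ∈ [0,1]`. [folklore] -/
theorem gam_mem {s : ℝ} (hs : s ∈ Icc (0 : ℝ) 1) : gam q r s ∈ cellU := segment_mem_cellU hq hr hs

/-- `H(s,σ) ∈ U` on the parameter square. [folklore] -/
theorem Hom_mem {s σ : ℝ} (hs : s ∈ Icc (0 : ℝ) 1) (hσ : σ ∈ Icc (0 : ℝ) 1) : Hom p q r s σ ∈ cellU :=
  segment_mem_cellU (gam_mem hq hr hs) hp hσ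

/-- The lines are positive along the clamped homotopy. [folklore] -/
theorem val_Hom_pos (ℓ : L5) (s σ : ℝ) : 0 < ℓ.val (Hom p q r (cl s) (cl σ)) :=
  ℓ.val_pos (Hom_mem hp hq hr (cl_mem s) (cl_mem σ))

/-- Joint continuity of `g`. [folklore] -/
theorem continuous_gMov (ℓ : L5) : Continuous fun z : ℝ × ℝ => gMov p q r ℓ z.1 z.2 := by
  have h1 : Continuous fun z : ℝ × ℝ => cl z.1 := continuous_cl.comp continuous_fst
  have h2 : Continuous fun z : ℝ × ℝ => cl z.2 := continuous_cl.comp continuous_snd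
  have hnum : Continuous fun z : ℝ × ℝ => ℓ.val p - (ℓ.val q + cl z.1 * ℓ.slope (r - q)) :=
    continuous_const.sub (continuous_const.add (h1.mul continuous_const))
  have hden : Continuous fun z : ℝ × ℝ => ℓ.val q + cl z.1 * ℓ.slope (r - q) +
      cl z.2 * (ℓ.val p - (ℓ.val q + cl z.1 * ℓ.slope (r - q))) :=
    (continuous_const.add (h1.mul continuous_const)).add (h2.mul hnum)
  have h : Continuous fun z : ℝ × ℝ => (ℓ.val p - (ℓ.val q + cl z.1 * ℓ.slope (r - q))) /
      (ℓ.val q + cl z.1 * ℓ.slope (r - q) + cl z.2 * (ℓ.val p - (ℓ.val q + cl z.1 * ℓ.slope (r - q)))) := by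
    refine hnum.div hden fun z => ?_
    have := val_Hom_pos hp hq hr ℓ z.1 z.2
    rw [val_Hom, val_gam] at this
    exact this.ne'
  convert h using 1
  funext z
  simp only [gMov, val_Hom, val_gam]

/-- Joint continuity of `g'`. [folklore] -/
theorem continuous_gMov' (ℓ : L5) : Continuous fun z : ℝ × ℝ => gMov' p q r ℓ z.1 z.2 := by
  have h1 : Continuous fun z : ℝ × ℝ => cl z.1 := continuous_cl.comp continuous_fst
  have h2 : Continuous fun z : ℝ × ℝ => cl z.2 := continuous_cl.comp continuous_snd
  have hden : Continuous fun z : ℝ × ℝ => (ℓ.val q + cl z.1 * ℓ.slope (r - q) +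
      cl z.2 * (ℓ.val p - (ℓ.val q + cl z.1 * ℓ.slope (r - q)))) ^ 2 :=
    ((continuous_const.add (h1.mul continuous_const)).add
      (h2.mul (continuous_const.sub (continuous_const.add (h1.mul continuous_const))))).pow 2
  have h : Continuous fun z : ℝ × ℝ => -(ℓ.slope (r - q) * ℓ.val p) /
      (ℓ.val q + cl z.1 * ℓ.slope (r - q) + cl z.2 * (ℓ.val p - (ℓ.val q + cl z.1 * ℓ.slope (r - q)))) ^ 2 := by
    refine continuous_const.div hden fun z => pow_ne_zero 2 ?_
    have := val_Hom_pos hp hq hr ℓ z.1 z.2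
    rw [val_Hom, val_gam] at this
    exact this.ne'
  convert h using 1
  funext z
  simp only [gMov', val_Hom, val_gam]

/-- Joint continuity of `h`. [folklore] -/
theorem continuous_hMov (ℓ : L5) : Continuous fun z : ℝ × ℝ => hMov p q r ℓ z.1 z.2 := by
  have h1 : Continuous fun z : ℝ × ℝ => cl z.1 := continuous_cl.comp continuous_fst
  have h2 : Continuous fun z : ℝ × ℝ => cl z.2 := continuous_cl.comp continuous_snd
  have hnum : Continuous fun z : ℝ × ℝ => (1 - cl z.2) * ℓ.slope (r - q) :=
    (continuous_const.sub h2).mul continuous_const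
  have hden : Continuous fun z : ℝ × ℝ => ℓ.val q + cl z.1 * ℓ.slope (r - q) +
      cl z.2 * (ℓ.val p - (ℓ.val q + cl z.1 * ℓ.slope (r - q))) :=
    (continuous_const.add (h1.mul continuous_const)).add
      (h2.mul (continuous_const.sub (continuous_const.add (h1.mul continuous_const))))
  have h : Continuous fun z : ℝ × ℝ => (1 - cl z.2) * ℓ.slope (r - q) /
      (ℓ.val q + cl z.1 * ℓ.slope (r - q) + cl z.2 * (ℓ.val p - (ℓ.val q + cl z.1 * ℓ.slope (r - q)))) := by
    refine hnum.div hden fun z => ?_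
    have := val_Hom_pos hp hq hr ℓ z.1 z.2
    rw [val_Hom, val_gam] at this
    exact this.ne'
  convert h using 1
  funext z
  simp only [hMov, val_Hom, val_gam]

/-- `∂_s g = g'` for `s ∈ (0,1)`. [folklore] -/
theorem hasDerivAt_gMov (ℓ : L5) {s : ℝ} (hs : s ∈ Ioo (0 : ℝ) 1) (τ : ℝ) :
    HasDerivAt (fun x => gMov p q r ℓ x τ) (gMov' p q r ℓ s τ) s := by
  -- near `s`, the clamp in `s` is the identity
  have hev : (fun x => gMov p q r ℓ x τ) =ᶠ[𝓝 s]
      fun x => (ℓ.val p - (ℓ.val q + x * ℓ.slope (r - q))) /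
        (ℓ.val q + x * ℓ.slope (r - q) + cl τ * (ℓ.val p - (ℓ.val q + x * ℓ.slope (r - q)))) := by
    filter_upwards [cl_eventuallyEq hs] with x hx
    simp only [gMov, val_Hom, val_gam, hx, id]
  refine HasDerivAt.congr_of_eventuallyEq ?_ hev
  have hden : ℓ.val q + s * ℓ.slope (r - q) + cl τ * (ℓ.val p - (ℓ.val q + s * ℓ.slope (r - q))) ≠ 0 := by
    have := val_Hom_pos hp hq hr ℓ s τ
    rw [val_Hom, val_gam, cl_of_mem ⟨hs.1.le, hs.2.le⟩] at this
    exact this.ne'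
  have hnum := (((hasDerivAt_id s).mul_const (ℓ.slope (r - q))).const_add (ℓ.val q)).const_sub (ℓ.val p)
  have hden' := (((hasDerivAt_id s).mul_const (ℓ.slope (r - q))).const_add (ℓ.val q)).add
    (hnum.const_mul (cl τ))
  have h := hnum.div hden' (by simpa using hden)
  refine h.congr_deriv ?_
  simp only [gMov', val_Hom, val_gam, cl_of_mem ⟨hs.1.le, hs.2.le⟩, id, Pi.add_apply]
  field_simp
  ring

/-- `∂_σ h = g'` for `σ ∈ (0,1)` (equality of mixed partials of `log ℓ(H)`). [folklore] -/
theorem hasDerivAt_hMov (ℓ : L5) (s : ℝ) {σ : ℝ} (hσ : σ ∈ Ioo (0 : ℝ) 1) :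
    HasDerivAt (fun x => hMov p q r ℓ s x) (gMov' p q r ℓ s σ) σ := by
  have hev : (fun x => hMov p q r ℓ s x) =ᶠ[𝓝 σ]
      fun x => (1 - x) * ℓ.slope (r - q) /
        (ℓ.val (gam q r (cl s)) + x * (ℓ.val p - ℓ.val (gam q r (cl s)))) := by
    filter_upwards [cl_eventuallyEq hσ] with x hx
    simp only [hMov, val_Hom, hx, id]
  refine HasDerivAt.congr_of_eventuallyEq ?_ hev
  have hden : ℓ.val (gam q r (cl s)) + σ * (ℓ.val p - ℓ.val (gam q r (cl s))) ≠ 0 := by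
    have := val_Hom_pos hp hq hr ℓ s σ
    rw [val_Hom, cl_of_mem ⟨hσ.1.le, hσ.2.le⟩] at this
    exact this.ne'
  have hnum := ((hasDerivAt_id σ).const_sub 1).mul_const (ℓ.slope (r - q))
  have hden' := ((hasDerivAt_id σ).mul_const (ℓ.val p - ℓ.val (gam q r (cl s)))).const_add
    (ℓ.val (gam q r (cl s)))
  have h := hnum.div hden' (by simpa using hden)
  refine h.congr_deriv ?_
  simp only [gMov', val_Hom, cl_of_mem ⟨hσ.1.le, hσ.2.le⟩, id]
  field_simp
  ring

omit hp hq hr in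

/-- `h_ℓ(s, 1) = 0` (the endpoint `p` is fixed). [folklore] -/
theorem hMov_one (ℓ : L5) (s : ℝ) : hMov p q r ℓ s 1 = 0 := by
  simp [hMov, cl_of_mem (show (1 : ℝ) ∈ Icc (0 : ℝ) 1 from ⟨zero_le_one, le_rfl⟩)]

omit hp hq hr in

/-- `h_ℓ(s, 0)` is the density of the path `q → r` at `s`. [folklore] -/
theorem hMov_zero (ℓ : L5) {s : ℝ} (hs : s ∈ Icc (0 : ℝ) 1) : hMov p q r ℓ s 0 = segDens q r ℓ s := by
  simp only [hMov, segDens, cl_of_mem (show (0 : ℝ) ∈ Icc (0 : ℝ) 1 from ⟨le_rfl, zero_le_one⟩),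
    cl_of_mem hs, sub_zero, one_mul, val_Hom, zero_mul, add_zero]
  rfl

omit hp hq hr in

/-- On the parameter square, `g(s,·)` is the segment density of `γ(s) → p`. [folklore] -/
theorem gMov_eq_segDens (ℓ : L5) {s σ : ℝ} (hs : s ∈ Icc (0 : ℝ) 1) (hσ : σ ∈ Icc (0 : ℝ) 1) :
    gMov p q r ℓ s σ = segDens (gam q r s) p ℓ σ := by
  simp only [gMov, segDens, cl_of_mem hs, cl_of_mem hσ, L5.slope_sub, Hom]

end Moving

/-! ## 6. Two generic complements to `DrinfeldAssociatorParametric.lean` (pointwise hypotheses) -/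

section Complements

universe u
variable {α : Type u}

/-- If two density families agree on `[a, b]`, their iterated integrals over sub-intervals agree.
[folklore] -/
theorem iterInt_congr {f f' : α → ℝ → ℝ} {a b : ℝ} (h : ∀ c, EqOn (f c) (f' c) (uIcc a b)) :
    ∀ (w : List α) {b' : ℝ}, b' ∈ uIcc a b → iterInt f w a b' = iterInt f' w a b'
  | [], _, _ => rfl
  | c :: w, b', hb' => by
    rw [iterInt_cons, iterInt_cons]
    refine intervalIntegral.integral_congr fun t ht => ?_
    have ht' : t ∈ uIcc a b := uIcc_subset_uIcc_left hb' ht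
    simp only [h c ht', iterInt_congr h w ht']

/-- Transport series only depend on the densities on `[a,b]`. [folklore] -/
theorem transportSeries_congr {f f' : α → ℝ → ℝ} {a b : ℝ} (h : ∀ c, EqOn (f c) (f' c) (uIcc a b)) :
    transportSeries f a b = transportSeries f' a b := by
  ext w; exact iterInt_congr h w right_mem_uIcc

variable {g g' h : α → ℝ → ℝ → ℝ}
  (hg : ∀ c, Continuous fun p : ℝ × ℝ => g c p.1 p.2)
  (hg' : ∀ c, Continuous fun p : ℝ × ℝ => g' c p.1 p.2)
include hg hg' in

/-- `hasDerivAt_pM` of `DrinfeldAssociatorParametric.lean` with the hypothesis `∂_σ h = g'` only at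
the point `σ`. [folklore] -/
theorem hasDerivAt_pM_at {s : ℝ} (σ : ℝ) (hh : ∀ c, HasDerivAt (fun x => h c s x) (g' c s σ) σ)
    (w : List α) :
    HasDerivAt (fun x => pM g g' h s x w)
      ((NCSeries.letterSeries (fun c => g c s σ) * pM g g' h s σ +
        (NCSeries.letterSeries (fun c => g c s σ) * NCSeries.letterSeries (fun c => h c s σ) -
          NCSeries.letterSeries (fun c => h c s σ) * NCSeries.letterSeries (fun c => g c s σ)) *
            pJ g s σ) w) σ := by
  set G := NCSeries.letterSeries (fun c => g c s σ) with hG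
  set G' := NCSeries.letterSeries (fun c => g' c s σ) with hG'
  set B := NCSeries.letterSeries (fun c => h c s σ) with hB
  set B0 := NCSeries.letterSeries (fun c => h c s 0) with hB0
  have h1 := hasDerivAt_pDser hg hg' s σ
  have h2 : ∀ w, HasDerivAt (fun x => (NCSeries.letterSeries (fun c => h c s x) * pJ g s x) w)
      ((G' * pJ g s σ + B * (G * pJ g s σ)) w) σ :=
    hasDerivAt_mul_apply (hasDerivAt_letterSeries hh) (hasDerivAt_pJ hg s σ)
  have h3 : ∀ w, HasDerivAt (fun x => (pJ g s x * B0) w) ((G * pJ g s σ * B0 + pJ g s σ * 0) w) σ :=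
    hasDerivAt_mul_apply (hasDerivAt_pJ hg s σ) (fun w => by simpa using hasDerivAt_const σ (B0 w))
  have h4 : HasDerivAt (fun x => pM g g' h s x w)
      ((G' * pJ g s σ + G * pDser g g' s σ) w - (G' * pJ g s σ + B * (G * pJ g s σ)) w +
        (G * pJ g s σ * B0 + pJ g s σ * 0) w) σ :=
    ((h1 w).sub (h2 w)).add (h3 w)
  have key : G * pM g g' h s σ + (G * B - B * G) * pJ g s σ =
      (G' * pJ g s σ + G * pDser g g' s σ) - (G' * pJ g s σ + B * (G * pJ g s σ)) +
        (G * pJ g s σ * B0 + pJ g s σ * 0) := by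
    simp only [pM, ← hB, ← hB0, mul_zero, add_zero]
    noncomm_ring
  refine h4.congr_deriv ?_
  rw [← NCSeries.sub_apply, ← NCSeries.add_apply, ← key]

variable [Fintype α] [DecidableEq α] {A : Type*} [Ring A] [Algebra ℝ A]

omit hg hg' in

/-- `evalTrunc_eq_zero_of_hasDerivAt` of `DrinfeldAssociatorParametric.lean` with the derivative
only on the OPEN interval and continuity on the closed one. [folklore] -/
theorem evalTrunc_eq_zero_of_hasDerivAt' (N K : ℕ) (v : α → A)
    (hv : ∀ w : List α, N < w.length → (w.map v).prod = 0)
    (T : ℕ → Submodule ℝ A) (hT0 : T 0 = ⊤) (hTK : T K = ⊥)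
    (hTmul : ∀ j c, ∀ x ∈ T j, v c * x ∈ T (j + 1))
    {a b : ℝ} (M D : ℝ → NCSeries α ℝ) (k : α → ℝ → ℝ)
    (hderiv : ∀ w, ∀ σ ∈ Ioo a b, HasDerivAt (fun x => M x w) (D σ w) σ)
    (hMcont : ∀ w, ContinuousOn (fun σ => M σ w) (Icc a b))
    (hcont : ∀ w, ContinuousOn (fun σ => D σ w) (Icc a b))
    (hflat : ∀ σ ∈ Icc a b, NCSeries.evalTrunc N v (D σ) =
      NCSeries.evalTrunc N v (NCSeries.letterSeries (fun c => k c σ) * M σ))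
    (h0 : NCSeries.evalTrunc N v (M a) = 0) :
    ∀ σ ∈ Icc a b, NCSeries.evalTrunc N v (M σ) = 0 := by
  have step : ∀ j, ∀ σ ∈ Icc a b, NCSeries.evalTrunc N v (M σ) ∈ T j := by
    intro j
    induction j with
    | zero => intro σ _; rw [hT0]; trivial
    | succ j ih =>
      intro σ hσ
      have hsub : Icc a σ ⊆ Icc a b := Icc_subset_Icc_right hσ.2
      have hmem : ∀ τ ∈ uIcc a σ, NCSeries.evalTrunc N v (D τ) ∈ T (j + 1) := by
        intro τ hτ
        rw [uIcc_of_le hσ.1] at hτ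
        have hτ' : τ ∈ Icc a b := hsub hτ
        rw [hflat τ hτ', NCSeries.evalTrunc_mul N v hv, evalTrunc_eq_sum, Finset.sum_mul]
        refine Submodule.sum_mem _ fun w _ => ?_
        match w with
        | [] => simp
        | [c] => simpa [smul_mul_assoc] using Submodule.smul_mem _ _ (hTmul j c _ (ih τ hτ'))
        | c :: d :: w => simp [NCSeries.letterSeries_cons_cons]
      have h := evalTrunc_sub_mem_of_integral N v (T (j + 1)) (a := a) (b := σ) M D
        (fun w => ((hcont w).mono hsub).intervalIntegrable_of_Icc hσ.1)
        (fun w => (integral_eq_sub_of_hasDerivAt_of_le hσ.1 ((hMcont w).mono hsub)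
          (fun τ hτ => hderiv w τ ⟨hτ.1, hτ.2.trans_le hσ.2⟩)
          (((hcont w).mono hsub).intervalIntegrable_of_Icc hσ.1)).symm) hmem
      rwa [h0, sub_zero] at h
  intro σ hσ
  have := step K σ hσ
  rwa [hTK, Submodule.mem_bot] at this

omit hg hg' [Fintype α] [DecidableEq α] in

/-- Coefficients of a product of coefficientwise-continuous families of series are continuous.
[folklore] -/
theorem continuousOn_mul_apply {S : Set ℝ} {P Q : ℝ → NCSeries α ℝ}
    (hP : ∀ w, ContinuousOn (fun x => P x w) S) (hQ : ∀ w, ContinuousOn (fun x => Q x w) S)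
    (w : List α) : ContinuousOn (fun x => (P x * Q x) w) S := by
  simp only [NCSeries.mul_apply]
  exact continuousOn_finsetSum _ fun p _ => (hP p.1).mul (hQ p.2)

end Complements

/-! ## 7. The variation of the transport from a moving point: `ev(∂_s T̂(γ(s)→p)) = -ev(T̂) Ω(γ'(s))` -/

section SigmaArg

variable (N : ℕ) {p q r : ℝ × ℝ} (hp : p ∈ cellU) (hq : q ∈ cellU) (hr : r ∈ cellU)
include hp hq hr

omit hp hq hr in
/-- `ev ĝ(σ) = Ω_{H(s,σ)}(p - γ(s))`. [folklore] -/
theorem ev_gLetter {s σ : ℝ} (hs : s ∈ Icc (0 : ℝ) 1) (hσ : σ ∈ Icc (0 : ℝ) 1) :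
    ev N (NCSeries.letterSeries fun ℓ => gMov p q r ℓ s σ) = Omega N (Hom p q r s σ) (p - gam q r s) := by
  rw [← ev_letterSeries_eq_Omega]
  congr 1; funext ℓ
  simp only [gMov, cl_of_mem hs, cl_of_mem hσ, L5.slope_sub]

omit hp hq hr in
/-- `ev b̂(σ) = Ω_{H(s,σ)}((1-σ)(r - q))`. [folklore] -/
theorem ev_hLetter {s σ : ℝ} (hs : s ∈ Icc (0 : ℝ) 1) (hσ : σ ∈ Icc (0 : ℝ) 1) :
    ev N (NCSeries.letterSeries fun ℓ => hMov p q r ℓ s σ) = Omega N (Hom p q r s σ) ((1 - σ) • (r - q)) := by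
  rw [← ev_letterSeries_eq_Omega]
  congr 1; funext ℓ
  simp only [hMov, cl_of_mem hs, cl_of_mem hσ, L5.slope_smul]

/-- Flatness along the homotopy: `ev [ĝ(σ), b̂(σ)] = 0`. [folklore] -/
theorem ev_commutator_eq_zero {s σ : ℝ} (hs : s ∈ Icc (0 : ℝ) 1) (hσ : σ ∈ Icc (0 : ℝ) 1) :
    ev N (NCSeries.letterSeries (fun ℓ => gMov p q r ℓ s σ) * NCSeries.letterSeries (fun ℓ => hMov p q r ℓ s σ) -
      NCSeries.letterSeries (fun ℓ => hMov p q r ℓ s σ) * NCSeries.letterSeries (fun ℓ => gMov p q r ℓ s σ)) = 0 := by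
  have h1 := ev_gLetter N (p := p) (q := q) (r := r) hs hσ
  have h2 := ev_hLetter N (p := p) (q := q) (r := r) hs hσ
  have hc := Omega_comm N (Hom_mem hp hq hr hs hσ) (p - gam q r s) ((1 - σ) • (r - q))
  rw [ev_sub, ev_mul, ev_mul, h1, h2, hc, sub_self]

/-- **The variation vanishes**: `ev(M̂(σ)) = 0` for `σ ∈ [0,1]`, at every `s ∈ [0,1]` (variation
identity + flatness + nilpotent uniqueness). [cite: Drinfeld1991, §2] -/
theorem ev_pM_eq_zero {s : ℝ} (hs : s ∈ Icc (0 : ℝ) 1) :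
    ∀ σ ∈ Icc (0 : ℝ) 1, ev N (pM (gMov p q r) (gMov' p q r) (hMov p q r) s σ) = 0 := by
  have hgc := continuous_gMov hp hq hr
  have hg'c := continuous_gMov' hp hq hr
  have hhc := continuous_hMov hp hq hr
  -- continuity in σ of the coefficients of the various series
  have cJ : ∀ w, ContinuousOn (fun σ => pJ (gMov p q r) s σ w) (Icc 0 1) := fun w =>
    ((continuous_pF hgc w).comp (Continuous.prodMk_right s)).continuousOn
  have cD : ∀ w, ContinuousOn (fun σ => pDser (gMov p q r) (gMov' p q r) s σ w) (Icc 0 1) := fun w =>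
    ((continuous_pD hgc hg'c w).comp (Continuous.prodMk_right s)).continuousOn
  have cLg : ∀ w, ContinuousOn (fun σ => NCSeries.letterSeries (fun ℓ => gMov p q r ℓ s σ) w) (Icc 0 1) := by
    intro w
    match w with
    | [] => simpa using continuousOn_const
    | [ℓ] =>
      simp only [NCSeries.letterSeries_singleton]
      exact ((hgc ℓ).comp (Continuous.prodMk_right s)).continuousOn
    | c :: d :: w => simpa [NCSeries.letterSeries_cons_cons] using continuousOn_const
  have cLh : ∀ w, ContinuousOn (fun σ => NCSeries.letterSeries (fun ℓ => hMov p q r ℓ s σ) w) (Icc 0 1) := by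
    intro w
    match w with
    | [] => simpa using continuousOn_const
    | [ℓ] =>
      simp only [NCSeries.letterSeries_singleton]
      exact ((hhc ℓ).comp (Continuous.prodMk_right s)).continuousOn
    | c :: d :: w => simpa [NCSeries.letterSeries_cons_cons] using continuousOn_const
  have cJB0 : ∀ w, ContinuousOn (fun σ => (pJ (gMov p q r) s σ *
      NCSeries.letterSeries (fun ℓ => hMov p q r ℓ s 0)) w) (Icc 0 1) :=
    continuousOn_mul_apply (P := fun σ => pJ (gMov p q r) s σ)
      (Q := fun _ => NCSeries.letterSeries (fun ℓ => hMov p q r ℓ s 0)) cJ (fun w => continuousOn_const)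
  have cLhJ : ∀ w, ContinuousOn (fun σ => (NCSeries.letterSeries (fun ℓ => hMov p q r ℓ s σ) *
      pJ (gMov p q r) s σ) w) (Icc 0 1) :=
    continuousOn_mul_apply (P := fun σ => NCSeries.letterSeries (fun ℓ => hMov p q r ℓ s σ))
      (Q := fun σ => pJ (gMov p q r) s σ) cLh cJ
  have cM : ∀ w, ContinuousOn (fun σ => pM (gMov p q r) (gMov' p q r) (hMov p q r) s σ w) (Icc 0 1) := by
    intro w
    have h := ((cD w).sub (cLhJ w)).add (cJB0 w)
    exact h
  set Dfun : ℝ → NCSeries L5 ℝ := fun σ => NCSeries.letterSeries (fun ℓ => gMov p q r ℓ s σ) *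
        pM (gMov p q r) (gMov' p q r) (hMov p q r) s σ +
      (NCSeries.letterSeries (fun ℓ => gMov p q r ℓ s σ) * NCSeries.letterSeries (fun ℓ => hMov p q r ℓ s σ) -
        NCSeries.letterSeries (fun ℓ => hMov p q r ℓ s σ) * NCSeries.letterSeries (fun ℓ => gMov p q r ℓ s σ)) *
          pJ (gMov p q r) s σ with hDfun
  have hderiv : ∀ w, ∀ σ ∈ Ioo (0 : ℝ) 1,
      HasDerivAt (fun x => pM (gMov p q r) (gMov' p q r) (hMov p q r) s x w) (Dfun σ w) σ := fun w σ hσ =>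
    hasDerivAt_pM_at hgc hg'c σ (fun ℓ => hasDerivAt_hMov hp hq hr ℓ s hσ) w
  have cGM : ∀ w, ContinuousOn (fun σ => (NCSeries.letterSeries (fun ℓ => gMov p q r ℓ s σ) *
      pM (gMov p q r) (gMov' p q r) (hMov p q r) s σ) w) (Icc 0 1) :=
    continuousOn_mul_apply (P := fun σ => NCSeries.letterSeries (fun ℓ => gMov p q r ℓ s σ))
      (Q := fun σ => pM (gMov p q r) (gMov' p q r) (hMov p q r) s σ) cLg cM
  have cGH : ∀ w, ContinuousOn (fun σ => (NCSeries.letterSeries (fun ℓ => gMov p q r ℓ s σ) *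
      NCSeries.letterSeries (fun ℓ => hMov p q r ℓ s σ)) w) (Icc 0 1) :=
    continuousOn_mul_apply (P := fun σ => NCSeries.letterSeries (fun ℓ => gMov p q r ℓ s σ))
      (Q := fun σ => NCSeries.letterSeries (fun ℓ => hMov p q r ℓ s σ)) cLg cLh
  have cHG : ∀ w, ContinuousOn (fun σ => (NCSeries.letterSeries (fun ℓ => hMov p q r ℓ s σ) *
      NCSeries.letterSeries (fun ℓ => gMov p q r ℓ s σ)) w) (Icc 0 1) :=
    continuousOn_mul_apply (P := fun σ => NCSeries.letterSeries (fun ℓ => hMov p q r ℓ s σ))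
      (Q := fun σ => NCSeries.letterSeries (fun ℓ => gMov p q r ℓ s σ)) cLh cLg
  have cComm : ∀ w, ContinuousOn (fun σ =>
      (NCSeries.letterSeries (fun ℓ => gMov p q r ℓ s σ) * NCSeries.letterSeries (fun ℓ => hMov p q r ℓ s σ) -
        NCSeries.letterSeries (fun ℓ => hMov p q r ℓ s σ) * NCSeries.letterSeries (fun ℓ => gMov p q r ℓ s σ)) w)
      (Icc 0 1) := fun w => (cGH w).sub (cHG w)
  have cCommJ : ∀ w, ContinuousOn (fun σ =>
      ((NCSeries.letterSeries (fun ℓ => gMov p q r ℓ s σ) * NCSeries.letterSeries (fun ℓ => hMov p q r ℓ s σ) -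
        NCSeries.letterSeries (fun ℓ => hMov p q r ℓ s σ) * NCSeries.letterSeries (fun ℓ => gMov p q r ℓ s σ)) *
          pJ (gMov p q r) s σ) w) (Icc 0 1) :=
    continuousOn_mul_apply (P := fun σ =>
      NCSeries.letterSeries (fun ℓ => gMov p q r ℓ s σ) * NCSeries.letterSeries (fun ℓ => hMov p q r ℓ s σ) -
        NCSeries.letterSeries (fun ℓ => hMov p q r ℓ s σ) * NCSeries.letterSeries (fun ℓ => gMov p q r ℓ s σ))
      (Q := fun σ => pJ (gMov p q r) s σ) cComm cJ
  have hDcont : ∀ w, ContinuousOn (fun σ => Dfun σ w) (Icc 0 1) := fun w => (cGM w).add (cCommJ w)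
  have hflat : ∀ σ ∈ Icc (0 : ℝ) 1, ev N (Dfun σ) =
      ev N (NCSeries.letterSeries (fun ℓ => gMov p q r ℓ s σ) * pM (gMov p q r) (gMov' p q r) (hMov p q r) s σ) := by
    intro σ hσ
    simp only [hDfun]
    rw [ev_add, ev_mul _ _ (pJ (gMov p q r) s σ), ev_commutator_eq_zero N hp hq hr hs hσ, zero_mul, add_zero]
  have h0 : ev N (pM (gMov p q r) (gMov' p q r) (hMov p q r) s 0) = 0 := by
    rw [pM_zero]; exact ev_zero N
  exact evalTrunc_eq_zero_of_hasDerivAt' N (N + 1) (tOf N) (tOf_nilpotent N) (Tfil N) (Tfil_zero N)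
    (Tfil_succ_N N) (fun j c x hx => tOf_mul_mem_Tfil N j c hx)
    (fun σ => pM (gMov p q r) (gMov' p q r) (hMov p q r) s σ) Dfun (fun ℓ σ => gMov p q r ℓ s σ)
    hderiv cM hDcont hflat h0

/-- **`ev(∂_s T̂(γ(s)→p)) = -ev(T̂(γ(s)→p)) ev(ω̂(s))`**, `ω̂(s)` the letter series of the path `q →
r` at `s`. [folklore] -/
theorem ev_pDser_one {s : ℝ} (hs : s ∈ Icc (0 : ℝ) 1) :
    ev N (pDser (gMov p q r) (gMov' p q r) s 1) =
      -(ev N (pJ (gMov p q r) s 1) * ev N (NCSeries.letterSeries fun ℓ => segDens q r ℓ s)) := by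
  have h := ev_pM_eq_zero N hp hq hr hs 1 ⟨zero_le_one, le_rfl⟩
  have h1 : NCSeries.letterSeries (fun ℓ => hMov p q r ℓ s 1) = 0 := by
    ext w
    match w with
    | [] => rfl
    | [ℓ] => simp [hMov_one]
    | c :: d :: w => rfl
  have h0 : NCSeries.letterSeries (fun ℓ => hMov p q r ℓ s 0) = NCSeries.letterSeries fun ℓ => segDens q r ℓ s := by
    congr 1; funext ℓ; exact hMov_zero ℓ hs
  rw [pM, h1, zero_mul, sub_zero, h0, ev_add, ev_mul] at h
  exact eq_neg_of_add_eq_zero_left h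

end SigmaArg

/-! ## 8. The triangle and the pentagon loop -/

section Triangle

variable (N : ℕ) {p q r : ℝ × ℝ} (hp : p ∈ cellU) (hq : q ∈ cellU) (hr : r ∈ cellU)
include hp hq hr

omit hp hq hr in

/-- For `s ∈ [0,1]`, `Ĵ(1)` at parameter `s` is the segment transport `T̂(γ(s) → p)`. [folklore] -/
theorem pJ_one_eq_segT {s : ℝ} (hs : s ∈ Icc (0 : ℝ) 1) : pJ (gMov p q r) s 1 = segT (gam q r s) p := by
  rw [pJ_eq_transportSeries, segT]
  refine transportSeries_congr fun ℓ σ hσ => ?_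
  rw [uIcc_of_le zero_le_one] at hσ
  exact gMov_eq_segDens ℓ hs hσ

/-- **Two sides of a triangle collapse**: `ev(T̂(r→p) T̂(q→r)) = ev(T̂(q→p))`. [cite: Drinfeld1991,
§2] -/
theorem ev_segT_mul_segT : ev N (segT r p * segT q r) = ev N (segT q p) := by
  -- the family X(s) = T̂(γ(s)→p) * T̂(q→γ(s))
  set B : ℝ → NCSeries L5 ℝ := fun s => pJ (gMov p q r) s 1 with hB
  set A : ℝ → NCSeries L5 ℝ := fun s => transportSeries (segDens q r) 0 s with hA
  set X : ℝ → NCSeries L5 ℝ := fun s => B s * A s with hX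
  set ω : ℝ → NCSeries L5 ℝ := fun s => NCSeries.letterSeries fun ℓ => segDens q r ℓ s with hω
  set X' : ℝ → NCSeries L5 ℝ := fun s =>
    pDser (gMov p q r) (gMov' p q r) s 1 * A s + B s * (ω s * A s) with hX'
  have hgc := continuous_gMov hp hq hr
  have hg'c := continuous_gMov' hp hq hr
  have hsub : Icc (0 : ℝ) 1 ⊆ segDom q r := Icc_subset_segDom hq hr
  have h0mem : (0 : ℝ) ∈ segDom q r := hsub ⟨le_rfl, zero_le_one⟩
  -- derivative of X on (0,1)
  have hderiv : ∀ w, ∀ s ∈ Ioo (0 : ℝ) 1, HasDerivAt (fun x => X x w) (X' s w) s := by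
    intro w s hs
    have hsA : ∀ w, HasDerivAt (fun x => A x w) ((ω s * A s) w) s := fun w =>
      hasDerivAt_transportSeries_right (isOpen_segDom q r) (ordConnected_segDom q r)
        (continuousOn_segDens q r) h0mem (hsub ⟨hs.1.le, hs.2.le⟩) w
    have hsB : ∀ w, HasDerivAt (fun x => B x w) (pDser (gMov p q r) (gMov' p q r) s 1 w) s := fun w =>
      hasDerivAt_pF hgc hg'c isOpen_Ioo (fun ℓ x hx τ => hasDerivAt_gMov hp hq hr ℓ hx τ) w hs 1
    exact hasDerivAt_mul_apply hsB hsA w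
  -- continuity of X and X' on [0,1]
  have cA : ∀ w, ContinuousOn (fun s => A s w) (Icc 0 1) := fun w =>
    (continuousOn_iterInt (isOpen_segDom q r) (ordConnected_segDom q r) (continuousOn_segDens q r)
      h0mem w).mono hsub
  have cB : ∀ w, ContinuousOn (fun s => B s w) (Icc 0 1) := fun w =>
    ((continuous_pF hgc w).comp (Continuous.prodMk_left (1 : ℝ))).continuousOn
  have cD : ∀ w, ContinuousOn (fun s => pDser (gMov p q r) (gMov' p q r) s 1 w) (Icc 0 1) := fun w =>
    ((continuous_pD hgc hg'c w).comp (Continuous.prodMk_left (1 : ℝ))).continuousOn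
  have cω : ∀ w, ContinuousOn (fun s => ω s w) (Icc 0 1) := by
    intro w
    show ContinuousOn (fun s => NCSeries.letterSeries (fun ℓ => segDens q r ℓ s) w) (Icc 0 1)
    match w with
    | [] => simpa using continuousOn_const
    | [ℓ] => simpa using (continuousOn_segDens q r ℓ).mono hsub
    | c :: d :: w => simpa [NCSeries.letterSeries_cons_cons] using continuousOn_const
  have cX : ∀ w, ContinuousOn (fun s => X s w) (Icc 0 1) := fun w => continuousOn_mul_apply cB cA w
  have cX' : ∀ w, ContinuousOn (fun s => X' s w) (Icc 0 1) := by
    intro w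
    simp only [hX', NCSeries.add_apply]
    exact (continuousOn_mul_apply cD cA w).add (continuousOn_mul_apply cB (continuousOn_mul_apply cω cA) w)
  -- ev(X') = 0 on [0,1]
  have hev : ∀ s ∈ Icc (0 : ℝ) 1, ev N (X' s) = 0 := by
    intro s hs
    show ev N (pDser (gMov p q r) (gMov' p q r) s 1 * A s + B s * (ω s * A s)) = 0
    rw [ev_add, ev_mul, ev_mul, ev_mul, ev_pDser_one N hp hq hr hs]
    noncomm_ring
  -- integrate
  have h := evalTrunc_sub_mem_of_integral N (tOf N) ⊥ (a := 0) (b := 1) X X'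
    (fun w => (cX' w).intervalIntegrable_of_Icc zero_le_one)
    (fun w => (integral_eq_sub_of_hasDerivAt_of_le zero_le_one (cX w) (fun s hs => hderiv w s hs)
      ((cX' w).intervalIntegrable_of_Icc zero_le_one)).symm)
    (fun s hs => by rw [uIcc_of_le zero_le_one] at hs; exact (Submodule.mem_bot ℝ).mpr (hev s hs))
  rw [Submodule.mem_bot, sub_eq_zero] at h
  -- identify the endpoints
  have hX1 : X 1 = segT r p * segT q r := by
    simp only [hX, hB, hA, pJ_one_eq_segT ⟨zero_le_one, le_rfl⟩, gam, one_smul, add_sub_cancel, segT]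
  have hX0 : X 0 = segT q p := by
    simp only [hX, hB, hA, pJ_one_eq_segT ⟨le_rfl, zero_le_one⟩, gam, zero_smul, add_zero,
      transportSeries_self, mul_one]
  rw [hX1, hX0] at h
  exact h

/-- **Trivial holonomy of the flat KZ connection around a triangle in the cell**: `ev(T̂(r→p))
ev(T̂(q→r)) ev(T̂(p→q)) = 1`. [cite: Drinfeld1991, §2] -/
theorem holonomy_triangle : ev N (segT r p) * ev N (segT q r) * ev N (segT p q) = 1 := by
  rw [← ev_mul, ev_segT_mul_segT N hp hq hr, ev_segT_reverse_mul N hp hq]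

end Triangle

section Pentagon

variable (N : ℕ)

/-- Two consecutive sides collapse: `ev(T̂(r→p)) ev(T̂(q→r)) = ev(T̂(q→p))`. [folklore] -/
theorem ev_segT_two {p q r : ℝ × ℝ} (hp : p ∈ cellU) (hq : q ∈ cellU) (hr : r ∈ cellU) :
    ev N (segT r p) * ev N (segT q r) = ev N (segT q p) := by
  rw [← ev_mul, ev_segT_mul_segT N hp hq hr]

/-- **Trivial holonomy around any closed pentagon in the cell** — the exact identity from which the
pentagon equation for `Φ_KZ` is extracted in the limit of a shrinking corner cut [Drinfeld1991, §2].
[cite: Drinfeld1991, §2] -/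
theorem holonomy_pentagon {P₁ P₂ P₃ P₄ P₅ : ℝ × ℝ} (h₁ : P₁ ∈ cellU) (h₂ : P₂ ∈ cellU) (h₃ : P₃ ∈ cellU)
    (h₄ : P₄ ∈ cellU) (h₅ : P₅ ∈ cellU) :
    ev N (segT P₅ P₁) * ev N (segT P₄ P₅) * ev N (segT P₃ P₄) * ev N (segT P₂ P₃) * ev N (segT P₁ P₂) = 1 := by
  rw [ev_segT_two N h₁ h₄ h₅, ev_segT_two N h₁ h₃ h₄, ev_segT_two N h₁ h₂ h₃, ev_segT_reverse_mul N h₁ h₂]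

end Pentagon

end Literature.NumberTheory.Transcendental
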